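import Summits.CriticalPhenomena.PercolationContinuityZ3.Theorems.PercNearOneGluingNoHeavyLowerTailSahiCoordinateChordPieces
import Summits.CriticalPhenomena.PercolationContinuityZ3.Theorems.SahiMasterFamilyPointwiseCoordinateGluingSettled
import Mathlib.Tactic.Linarith
import Mathlib.Tactic.Ring
import HarnessLib

/-!
# `NoHeavyLowerTail` (crux stmt-CriticalPhenomena-4575), master-family line P2: the TWO-THIRDS CONJECTURE (T3∀) — a universal one-coordinate inequality,
# census-clean and strictly stronger than "Bernstein-good coordinates everywhere" — typed, with its reduction to Kahn's `C_3`

Support file (seat `prim-masterthm-p2`, gen 11; `--supports stmt-CriticalPhenomena-4575`); ONE `@[conjecture]` definition (`TwoThirds`, an obligation of THIS programme —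
census-clean, NOT a published fact), no sorry.  Memo SAHI-ROUTE.md §4.34(h).

For an increasing triple `U = ![A, B, C]` on a finite cube, a product weight `μ_p` and a coordinate `e`, write `B₀, B₁, B₂, B₃` for the degree-3 Bernstein
coefficients of `s ↦ E_3(μ_{p[e↦s]}; 1_U)` (`B₀ = E_3(U^{e←0})`, `B₃ = E_3(U^{e←1})`; `b₂ = 3B₂ − B₀ − 2B₃ = SahiCoordinateBernstein.coordPiece₂`, in closed form
`Σ_cyc ν_A ν_{BC} − Σ_cyc m(A⁰)ν_Bν_C − 2ν_Aν_Bν_C` by `SahiCoordinateChord.coordPiece₂_eq`).  **CONJECTURE (T3∀, "two-thirds")** (`TwoThirds`):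
  `3·B₂(e) ≥ 2·B₃(e)`   for EVERY increasing triple, EVERY coordinate, EVERY product weight — equivalently `coordPiece₂(e) + E_3(U^{e←0}) ≥ 0`, equivalently
  `2m(A⁰B⁰C⁰) + mA¹mB¹mC¹ + Σ_cyc ν_A·Cov(B¹,C¹) ≥ Σ_cyc mA¹·m(B⁰C⁰)`.
CENSUS (seat, exact/float+exact): k = 4 EXHAUSTIVE (170³ ordered triples × 4 coordinates × 20 parameter vectors = 3.8·10⁸ cells), k = 3 exhaustive, adversarial
parameter minimisation on 9,740 (triple, e) pairs for k = 5, 6, 7: no violation; the mirror statements `3B₁ ≥ 2B₀`, `3B₂ ≥ B₀ + B₃` are FALSE (≈ 4 % at k = 3), and the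
universal CHORD form (`(1−t)b₁ + tb₂ ≥ 0` at every e) is false (master-conj's hexagon) — there (T3) holds with margin.  At a coordinate missed by one member (T3) is
equivalent to the quantitative Kahn inequality `E_3(F,G,H) ≥ μ(H)·μ(F^H∖F)·μ(G^H∖G)` (`X^H` the largest up-set agreeing with `X` inside `H`).
THIS FILE: (i) `TwoThirds` (typed); (ii) `coordPiece₂_le_coordPiece₁` (`b₁ − b₂ = ν_Aν_Bν_C ≥ 0` for increasing events); (iii) the LOCAL STEP
`sahiE_three_nonneg_of_twoThirdsAt`: (T3) at `e` plus `E_3 ≥ 0` for the two `e`-sections give `E_3 ≥ (1−t)²E_3(U^{e←0}) + tE_3(U^{e←1}) ≥ 0`; (iv) the REDUCTION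
`masterFamilyNonneg_three_of_twoThirds : TwoThirds → MasterFamilyNonneg 3` (induction on a determining set, as in master-conj's
`Pointwise.masterFamilyNonneg_three_of_bernsteinGoodCoordinate`; sections stay in the type `Set ι`).
HONEST FRAMING: a typed conjecture and its consequence; Kahn's Conjecture 5 / Sahi's `C_3` and (T3∀) remain OPEN.  Axioms standard. [this work]
-/

noncomputable section

open scoped Classical

namespace Summit.CriticalPhenomena.PercolationContinuityZ3.Theorems

namespace SahiCoordinateTwoThirds

open Finset Function
open Literature.Combinatorics.Sahi2008
open Literature.Probability.Percolation (DeterminedBy determinedBy_iff)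
open Literature.Probability.Percolation.DecisionTree (ind ind_of_mem ind_of_not_mem ind_nonneg)
open SahiCoordinateBernstein (coordPiece₁ coordPiece₂ sahiE_three_decomp_coord)

variable {ι : Type} [Fintype ι]

/-! ### 1. The conjecture, typed -/

/-- **CONJECTURE (T3∀, "two-thirds")**, an obligation of this programme (NOT a published fact): for every finite cube, every product weight `p`, every triple of
increasing events `A, B, C` and EVERY coordinate `e`, the second one-coordinate Bernstein piece is bounded below by minus `E_3` of the `0`-sections:
`coordPiece₂ p e ![A,B,C] + E_3(μ_p; A^{e←0}, B^{e←0}, C^{e←0}) ≥ 0` — i.e. `3B₂(e) ≥ 2B₃(e)` for the degree-3 Bernstein coefficients of `s ↦ E_3(μ_{p[e↦s]})`.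
Census: exhaustive on `2^[4]` (3.8·10⁸ cells) and `2^[3]`, adversarial k ≤ 7 — no violation (memo SAHI-ROUTE §4.34(h)).  Implies Kahn's `C_3`
(`masterFamilyNonneg_three_of_twoThirds`). [cite: Kahn2022, Conj. 5 (arXiv p. 3)] [status: open] -/
@[conjecture] def TwoThirds : Prop :=
  ∀ (ι : Type) [Fintype ι] (p : ι → unitInterval) (A B C : Set (Set ι)), IsUpperSet A → IsUpperSet B → IsUpperSet C →
    ∀ e : ι, 0 ≤ coordPiece₂ p e ![A, B, C] +
      sahiE (bernoulliWeight p) 3 ![ind (secAt e false A), ind (secAt e false B), ind (secAt e false C)]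

/-! ### 2. `b₂ ≤ b₁` for increasing events -/

/-- For increasing events the first Bernstein piece dominates the second: `b₁ − b₂ = ν_A ν_B ν_C ≥ 0`. [this work] -/
theorem coordPiece₂_le_coordPiece₁ (p : ι → unitInterval) (e : ι) {A B C : Set (Set ι)} (hA : IsUpperSet A) (hB : IsUpperSet B)
    (hC : IsUpperSet C) : coordPiece₂ p e ![A, B, C] ≤ coordPiece₁ p e ![A, B, C] := by
  have h := SahiCoordinateChord.coordPiece₁_sub_coordPiece₂_ex p e A B C
  have nA := Pointwise.ex_secAt_true_sub_false_nonneg p e hA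
  have nB := Pointwise.ex_secAt_true_sub_false_nonneg p e hB
  have nC := Pointwise.ex_secAt_true_sub_false_nonneg p e hC
  have hprod := mul_nonneg (mul_nonneg nA nB) nC
  linarith

/-! ### 3. The local step -/

omit [Fintype ι] in
/-- Sections of a triple, as a family. [folklore] -/
theorem ind_secAt_vec3 (e : ι) (b : Bool) (X Y W : Set (Set ι)) :
    (fun j => ind (secAt e b ((![X, Y, W] : Fin 3 → Set (Set ι)) j))) = ![ind (secAt e b X), ind (secAt e b Y), ind (secAt e b W)] := by
  funext j; fin_cases j <;> rfl

/-- **LOCAL STEP.**  (T3) at `e` for the increasing triple `(A,B,C)` together with `E_3 ≥ 0` for its two `e`-sections gives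
`E_3(μ_p; A, B, C) ≥ (1−t)²·E_3(A⁰,B⁰,C⁰) + t·E_3(A¹,B¹,C¹) ≥ 0` (`t = p_e`). [this work] -/
theorem sahiE_three_nonneg_of_twoThirdsAt (p : ι → unitInterval) (e : ι) {A B C : Set (Set ι)} (hA : IsUpperSet A) (hB : IsUpperSet B)
    (hC : IsUpperSet C)
    (hT3 : 0 ≤ coordPiece₂ p e ![A, B, C] + sahiE (bernoulliWeight p) 3 ![ind (secAt e false A), ind (secAt e false B), ind (secAt e false C)])
    (h0 : 0 ≤ sahiE (bernoulliWeight p) 3 ![ind (secAt e false A), ind (secAt e false B), ind (secAt e false C)])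
    (h1 : 0 ≤ sahiE (bernoulliWeight p) 3 ![ind (secAt e true A), ind (secAt e true B), ind (secAt e true C)]) :
    0 ≤ sahiE (bernoulliWeight p) 3 ![ind A, ind B, ind C] := by
  have hdec := sahiE_three_decomp_coord p e ![A, B, C]
  rw [Pointwise.ind_vec3, ind_secAt_vec3, ind_secAt_vec3] at hdec
  have h12 := coordPiece₂_le_coordPiece₁ p e hA hB hC
  have ht0 : 0 ≤ (p e : ℝ) := (p e).2.1
  have ht1' : (p e : ℝ) ≤ 1 := (p e).2.2
  have ht1 : 0 ≤ 1 - (p e : ℝ) := by linarith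
  -- the mixed piece is at least `−E_3(0-sections)`
  have hmix : -sahiE (bernoulliWeight p) 3 ![ind (secAt e false A), ind (secAt e false B), ind (secAt e false C)] ≤
      (1 - (p e : ℝ)) * coordPiece₁ p e ![A, B, C] + (p e : ℝ) * coordPiece₂ p e ![A, B, C] := by
    nlinarith [mul_nonneg ht1 (sub_nonneg.2 h12)]
  rw [hdec]
  have hpq : 0 ≤ (p e : ℝ) * (1 - (p e : ℝ)) := mul_nonneg ht0 ht1
  nlinarith [mul_le_mul_of_nonneg_left hmix hpq, mul_nonneg (pow_nonneg ht1 2) h0, mul_nonneg ht0 h1]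

/-! ### 4. The reduction: (T3∀) ⟹ Kahn's `C_3` -/

/-- **(T3∀) ⟹ Kahn's Conjecture 5 / Sahi's `C_3` for product measures** (induction on the size of a determining set; the sections of an increasing triple are
increasing triples determined by one coordinate fewer). [this work] -/
theorem masterFamilyNonneg_three_of_twoThirds (hT : TwoThirds) : MasterFamilyNonneg 3 := by
  intro κ _ p U hU
  suffices key : ∀ (m : ℕ) (V : Fin 3 → Set (Set κ)) (S : Finset κ), S.card = m → (∀ j, IsUpperSet (V j)) →
      (∀ j, DeterminedBy (V j) (↑S : Set κ)) → 0 ≤ sahiE (bernoulliWeight p) 3 (fun j => ind (V j)) from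
    key _ U Finset.univ rfl hU fun j => (determinedBy_iff _ _).2 fun ω ω' h => by
      rw [Finset.coe_univ, Set.inter_univ, Set.inter_univ] at h; rw [h]
  intro m
  induction m using Nat.strong_induction_on with
  | _ m ih =>
  intro V S hS hV hVS
  rcases S.eq_empty_or_nonempty with hSe | hSne
  · subst hSe
    exact (masterFamilyEqIff_mpr 3 κ p V (Pointwise.suppZeroFlag_three_of_determinedBy_empty V hVS)).ge
  · obtain ⟨e, heS⟩ := hSne
    have hlt : (S.erase e).card < m := by rw [← hS]; exact Finset.card_erase_lt_of_mem heS
    have E0 := ih _ hlt (fun j => secAt e false (V j)) (S.erase e) rfl (fun j => isUpperSet_secAt e false (hV j))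
      (fun j => determinedBy_secAt e false (hVS j))
    have E1 := ih _ hlt (fun j => secAt e true (V j)) (S.erase e) rfl (fun j => isUpperSet_secAt e true (hV j))
      (fun j => determinedBy_secAt e true (hVS j))
    -- rewrite the family `V` as the triple `![V 0, V 1, V 2]`
    have hVeq : V = ![V 0, V 1, V 2] := by funext j; fin_cases j <;> rfl
    rw [hVeq] at E0 E1 ⊢
    rw [ind_secAt_vec3] at E0 E1
    rw [Pointwise.ind_vec3]
    exact sahiE_three_nonneg_of_twoThirdsAt p e (hV 0) (hV 1) (hV 2) (hT κ p (V 0) (V 1) (V 2) (hV 0) (hV 1) (hV 2) e) E0 E1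

end SahiCoordinateTwoThirds

end Summit.CriticalPhenomena.PercolationContinuityZ3.Theorems
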